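import Mathlib
import Literature.MathematicalPhysics.QuantumFieldTheory.Luscher2010.TrivializingMaps
import Summits.Ventures.LatticeQCDFlow.TrivializingMaps.DefectLogWeight
import HarnessLib

/-!
# Measure-theoretic packaging: `DefectControlsLogWeight` from the Jacobian formula and global flows

HONEST FRAMING: exact (Metropolis-corrected) sampling algorithms for lattice gauge theory; figures of merit are
autocorrelation/cost numbers at stated couplings and volumes; no continuum-physics claim.

`DefectLogWeight.lean` proved the analytic half of Lüscher's §4.1 made quantitative: for the gradient ansatz
`Z_t = -∂S̃_t` (4.4) with flow-equation defect `|𝓛_t S̃_t - S - Ċ_t| ≤ δ` on `[0,1] × SU(n)^E`, the quantity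
`R(V) = ∫₀¹ div Z_s(𝓕_s V) ds - S(𝓕_1 V)` oscillates by at most `2δ`. This file supplies the measure-theoretic
half and proves the venture's typed target `DefectControlsLogWeight` (`Truncation.lean` §3) CONDITIONALLY on the
two cited analytic statements of Lüscher §3 that the Literature file records as named facts:
`FlowGlobalExistence` (global existence, uniqueness and joint continuity of tangent flows on `SU(n)^E`, §3.1) and
`JacobianFormula` (eq. (3.9), §3.2):

  `defectControlsLogWeight_of : FlowGlobalExistence d L n → JacobianFormula d L n → DefectControlsLogWeight d L n`.

* §1 gradient generators are `𝔰𝔲(n)`-valued and jointly `C¹` (also time-reversed); flow lines reverse.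
* §2 under `FlowGlobalExistence` a flow map is THE flow (jointly continuous) and `𝓕_1` has a continuous
  two-sided inverse, by integrating `+∂S̃_{1-t}` ("integrated backwards", §3.2); the Jacobian integral of (3.9)
  is continuous in the initial field.
* §3 finite Borel measures on the compact metrizable field manifold are separated by bounded continuous
  observables, so `∫ f·h dU = ∫ f(𝓕_1 V) dV ∀ f` (what (3.9) delivers) identifies `(𝓕_1)_* D[V] = h · D[U]`;
  Boltzmann reweighting `e^{-S-g} D[U] = (𝒵 e^{-g}) · 𝒵⁻¹e^{-S} D[U]` with `0 < 𝒵 < ∞`.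
* §4 the packaging theorem: (3.9) at `t = 1` tested against `f · e^{-S - R∘Ψ}` (`Ψ = 𝓕_1⁻¹`) gives
  `(𝓕_1)_* D[V] = e^{-S - R∘Ψ} D[U]`, whence `ρ = 𝒵 e^{-R∘Ψ}`, measurable, positive, `ρ(U) ≤ e^{2δ} ρ(U')`.
Cited and unproved remain exactly `FlowGlobalExistence` and `JacobianFormula` (Lüscher §3).

References: M. Lüscher, Trivializing maps, the Wilson flow and the HMC algorithm, CMP 293 (2010) 899
[Luscher2010Trivializing, arXiv:0907.5491], §2.1 eq. (2.2), §2.2 eq. (2.4), §3.1 eq. (3.2), §3.2 eq. (3.9),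
§4.1 eqs. (4.1)–(4.3), §4.2 eqs. (4.4)–(4.5), App. A.
-/

namespace Summit.Ventures.LatticeQCDFlow.TrivializingMaps

open MeasureTheory
open Literature.MathematicalPhysics.QuantumFieldTheory
open Literature.MathematicalPhysics.QuantumFieldTheory.Luscher2010
open scoped Matrix Matrix.Norms.Frobenius ContDiff BoundedContinuousFunction

variable {d L n : ℕ}

/-! ## §1. Gradient generators: tangency, joint regularity, time reversal -/

section Generators

/-- Each component `∂f(W)(e) = ∑_a (∂^a_e f)(W) T^a` of the link gradient lies in `𝔰𝔲(n)` (real span of the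
generators). [cite: Luscher2010Trivializing, §4.2 eq. (4.4), App. A eq. (A.1)] -/
theorem linkGrad_apply_mem_suAlgebra (B : SuBasis n) (f : AmbConfig d L n → ℝ) (W : AmbConfig d L n)
    (e : Edge d L) : linkGrad B f W e ∈ suAlgebra n := by
  show (∑ a, ((linkDeriv e (B.T a) f W : ℝ) : ℂ) • B.T a) ∈ suAlgebra n
  refine Submodule.sum_mem _ fun a _ => ?_
  rw [Complex.coe_smul]
  exact Submodule.smul_mem _ _ (B.mem a)

/-- Gradient generators `Z_t = -∂S̃_t` (ansatz (4.4)) take values in the Lie algebra, i.e. are tangent to the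
field manifold `SU(n)^E` (§3.1). [cite: Luscher2010Trivializing, §3.1, §4.2 eq. (4.4)] -/
theorem isTangent_neg_linkGrad (B : SuBasis n) (F : ℝ → AmbConfig d L n → ℝ) :
    Generator.IsTangent (fun t W => -linkGrad B (F t) W) := by
  intro t U e
  show -(linkGrad B (F t) (WilsonFlow.coeConfig U) e) ∈ suAlgebra n
  exact Submodule.neg_mem _ (linkGrad_apply_mem_suAlgebra B (F t) _ e)

/-- … and so do their time reversals `Z'_t = +∂S̃_{1-t}` (the flow "integrated backwards", §3.2).
[cite: Luscher2010Trivializing, §3.2, §4.2 eq. (4.4)] -/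
theorem isTangent_linkGrad_rev (B : SuBasis n) (F : ℝ → AmbConfig d L n → ℝ) :
    Generator.IsTangent (fun t W => linkGrad B (F (1 - t)) W) := by
  intro t U e
  exact linkGrad_apply_mem_suAlgebra B (F (1 - t)) _ e

/-- **Time reversal of flow lines**: if `U` is a flow line of `Z` then `s ↦ U(1-s)` is a flow line of the
reversed generator `(t, W) ↦ -Z_{1-t}(W)` ("the flow equation can be integrated backwards", §3.2).
[cite: Luscher2010Trivializing, §3.2] -/
theorem isFlowLine_reverse {Z : Generator d L n} {U : ℝ → AmbConfig d L n} (hU : IsFlowLine Z U) :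
    IsFlowLine (fun t W => -Z (1 - t) W) (fun s => U (1 - s)) := by
  intro s e i j
  have h := HasDerivAt.comp_const_sub 1 s (hU (1 - s) e i j)
  refine h.congr_deriv ?_
  simp only [Pi.neg_apply, neg_mul, Matrix.neg_apply]

/-- Flow lines only depend on the generator's values. [folklore] -/
theorem isFlowLine_congr_generator {Z Z' : Generator d L n} {U : ℝ → AmbConfig d L n}
    (hU : IsFlowLine Z U) (hZ : ∀ t W, Z t W = Z' t W) : IsFlowLine Z' U := by
  intro t e i j
  exact (hU t e i j).congr_deriv (by rw [hZ])

variable [NeZero L]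

/-- **Joint `C¹` regularity of a gradient generator**: if `(t, W) ↦ S̃_t(W)` is smooth then
`(t, W) ↦ Z_t(W) = -∂S̃_t(W)` is (jointly) `C¹` — the hypothesis of `FlowGlobalExistence` / `JacobianFormula`
(§3.1 "Z depends smoothly on t and U"; App. E for the flow action).
[cite: Luscher2010Trivializing, §3.1, §4.2 eq. (4.4), App. E] -/
theorem contDiff_one_neg_linkGrad_param (B : SuBasis n) {F : ℝ → AmbConfig d L n → ℝ}
    (hF : ContDiff ℝ ∞ fun p : ℝ × AmbConfig d L n => F p.1 p.2) :
    ContDiff ℝ 1 fun p : ℝ × AmbConfig d L n => -linkGrad B (F p.1) p.2 := by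
  refine ContDiff.neg ?_
  refine contDiff_pi.2 fun e => ?_
  show ContDiff ℝ 1 fun p : ℝ × AmbConfig d L n =>
    ∑ a, ((linkDeriv e (B.T a) (F p.1) p.2 : ℝ) : ℂ) • B.T a
  simp_rw [Complex.coe_smul]
  exact ContDiff.sum fun a _ =>
    ((contDiff_linkDeriv_param hF e (B.T a)).of_le (by simp)).smul contDiff_const

/-- Joint `C¹` regularity of the time-reversed gradient generator `(t, W) ↦ +∂S̃_{1-t}(W)`.
[cite: Luscher2010Trivializing, §3.1, §3.2, §4.2 eq. (4.4)] -/
theorem contDiff_one_linkGrad_rev_param (B : SuBasis n) {F : ℝ → AmbConfig d L n → ℝ}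
    (hF : ContDiff ℝ ∞ fun p : ℝ × AmbConfig d L n => F p.1 p.2) :
    ContDiff ℝ 1 fun p : ℝ × AmbConfig d L n => linkGrad B (F (1 - p.1)) p.2 := by
  have hF' : ContDiff ℝ ∞ fun p : ℝ × AmbConfig d L n => F (1 - p.1) p.2 :=
    hF.comp ((contDiff_const.sub contDiff_fst).prodMk contDiff_snd)
  have h := (contDiff_one_neg_linkGrad_param B (F := fun t W => F (1 - t) W) hF').neg
  simpa only [neg_neg] using h

/-- **The partition function of a continuous action is finite and non-zero** (compact field manifold,
normalised Haar measure). [cite: Luscher2010Trivializing, §2.1 eq. (2.2)] -/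
theorem partitionFn_ne_zero_and_ne_top
    {S : GaugeConfig d L (Matrix.specialUnitaryGroup (Fin n) ℂ) → ℝ} (hS : Continuous S) :
    partitionFn S ≠ 0 ∧ partitionFn S ≠ ⊤ := by
  haveI : IsProbabilityMeasure (trivialMeasure (Matrix.specialUnitaryGroup (Fin n) ℂ) d L) := by
    unfold trivialMeasure; infer_instance
  obtain ⟨C, hC⟩ := isCompact_univ.exists_bound_of_continuousOn hS.continuousOn
  have hC' : ∀ U, |S U| ≤ C := fun U => by simpa [Real.norm_eq_abs] using hC U (Set.mem_univ U)
  have hlo : ∀ U, ENNReal.ofReal (Real.exp (-C)) ≤ ENNReal.ofReal (Real.exp (-S U)) := fun U =>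
    ENNReal.ofReal_le_ofReal (Real.exp_le_exp.2 (by linarith [(abs_le.1 (hC' U)).2]))
  have hhi : ∀ U, ENNReal.ofReal (Real.exp (-S U)) ≤ ENNReal.ofReal (Real.exp C) := fun U =>
    ENNReal.ofReal_le_ofReal (Real.exp_le_exp.2 (by linarith [(abs_le.1 (hC' U)).1]))
  unfold partitionFn
  refine ⟨ne_of_gt (lt_of_lt_of_le ?_ (lintegral_mono hlo)),
    ne_of_lt (lt_of_le_of_lt (lintegral_mono hhi) ?_)⟩
  · rw [lintegral_const, measure_univ, mul_one]; exact ENNReal.ofReal_pos.2 (Real.exp_pos _)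
  · rw [lintegral_const, measure_univ, mul_one]; exact ENNReal.ofReal_lt_top

end Generators

/-! ## §2. Flow maps of gradient generators: uniqueness, continuity, inversion -/

section FlowMaps

variable [NeZero L]

/-- **A flow map is THE global flow**: under `FlowGlobalExistence`, any flow map `Φ` of a jointly `C¹`
tangent generator is jointly continuous in `(t, V)` and every flow line through `V` is `t ↦ Φ_t(V)`
(§3.1: "U_t is a well-defined function of the initial field V"). [cite: Luscher2010Trivializing, §3.1, §3.2] -/
theorem isFlowMap_continuous_unique (hGE : FlowGlobalExistence d L n) {Z : Generator d L n}
    (hZ1 : ContDiff ℝ 1 fun p : ℝ × AmbConfig d L n => Z p.1 p.2) (hZtan : Z.IsTangent)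
    {Φ : ℝ → GaugeConfig d L (Matrix.specialUnitaryGroup (Fin n) ℂ) →
      GaugeConfig d L (Matrix.specialUnitaryGroup (Fin n) ℂ)} (hΦ : IsFlowMap Z Φ) :
    Continuous (fun p : ℝ × GaugeConfig d L (Matrix.specialUnitaryGroup (Fin n) ℂ) => Φ p.1 p.2) ∧
      ∀ (U : ℝ → AmbConfig d L n) (V : GaugeConfig d L (Matrix.specialUnitaryGroup (Fin n) ℂ)),
        IsFlowLine Z U → U 0 = WilsonFlow.coeConfig V → ∀ t, U t = WilsonFlow.coeConfig (Φ t V) := by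
  obtain ⟨Φ₀, hΦ₀, hcont₀, huniq₀⟩ := hGE Z hZ1 hZtan
  have hΦeq : ∀ t V, Φ t V = Φ₀ t V := by
    intro t V
    apply WilsonFlow.coeConfig_injective
    exact huniq₀ (fun s => WilsonFlow.coeConfig (Φ s V)) V (hΦ.2 V)
      (show WilsonFlow.coeConfig (Φ 0 V) = _ by rw [hΦ.1 V]) t
  have hfun : Φ = Φ₀ := funext fun t => funext fun V => hΦeq t V
  subst hfun
  exact ⟨hcont₀, huniq₀⟩

/-- **Inversion by backward integration** (§3.2: "the transformation is invertible … because the flow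
equation can be integrated backwards from t to 0"): under `FlowGlobalExistence`, the time-one map `Φ₁` of a
gradient generator `Z_t = -∂S̃_t` (jointly smooth `S̃`) has a continuous two-sided inverse, namely the time-one
map of the reversed generator `+∂S̃_{1-t}`. [cite: Luscher2010Trivializing, §3.2] -/
theorem exists_continuous_inverse_flowMap_one (hGE : FlowGlobalExistence d L n) (B : SuBasis n)
    {F : ℝ → AmbConfig d L n → ℝ} (hF : ContDiff ℝ ∞ fun p : ℝ × AmbConfig d L n => F p.1 p.2)
    {Φ : ℝ → GaugeConfig d L (Matrix.specialUnitaryGroup (Fin n) ℂ) →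
      GaugeConfig d L (Matrix.specialUnitaryGroup (Fin n) ℂ)}
    (hΦ : IsFlowMap (fun t W => -linkGrad B (F t) W) Φ) :
    ∃ Ψ : GaugeConfig d L (Matrix.specialUnitaryGroup (Fin n) ℂ) →
        GaugeConfig d L (Matrix.specialUnitaryGroup (Fin n) ℂ),
      Continuous Ψ ∧ (∀ V, Ψ (Φ 1 V) = V) ∧ ∀ U, Φ 1 (Ψ U) = U := by
  obtain ⟨-, huniq⟩ := isFlowMap_continuous_unique hGE (contDiff_one_neg_linkGrad_param B hF)
    (isTangent_neg_linkGrad B F) hΦ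
  obtain ⟨Φr, hΦr, hcontr, huniqr⟩ := hGE (fun t W => linkGrad B (F (1 - t)) W)
    (contDiff_one_linkGrad_rev_param B hF) (isTangent_linkGrad_rev B F)
  refine ⟨Φr 1, hcontr.comp (continuous_const.prodMk continuous_id), fun V => ?_, fun U₀ => ?_⟩
  · have hrev : IsFlowLine (fun t W => linkGrad B (F (1 - t)) W)
        (fun s => WilsonFlow.coeConfig (Φ (1 - s) V)) :=
      isFlowLine_congr_generator (isFlowLine_reverse (hΦ.2 V)) fun t W => by simp only [neg_neg]
    have h0 : (fun s => WilsonFlow.coeConfig (Φ (1 - s) V)) 0 = WilsonFlow.coeConfig (Φ 1 V) := by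
      show WilsonFlow.coeConfig (Φ (1 - 0) V) = _
      rw [sub_zero]
    have h1 : WilsonFlow.coeConfig (Φ (1 - 1) V) = WilsonFlow.coeConfig (Φr 1 (Φ 1 V)) :=
      huniqr _ (Φ 1 V) hrev h0 1
    rw [sub_self, hΦ.1 V] at h1
    exact (WilsonFlow.coeConfig_injective h1).symm
  · have hrev' : IsFlowLine (fun t W => -linkGrad B (F t) W)
        (fun s => WilsonFlow.coeConfig (Φr (1 - s) U₀)) :=
      isFlowLine_congr_generator (isFlowLine_reverse (hΦr.2 U₀)) fun t W => by
        simp only [sub_sub_cancel]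
    have h0 : (fun s => WilsonFlow.coeConfig (Φr (1 - s) U₀)) 0 = WilsonFlow.coeConfig (Φr 1 U₀) := by
      show WilsonFlow.coeConfig (Φr (1 - 0) U₀) = _
      rw [sub_zero]
    have h1 : WilsonFlow.coeConfig (Φr (1 - 1) U₀) = WilsonFlow.coeConfig (Φ 1 (Φr 1 U₀)) :=
      huniq _ (Φr 1 U₀) hrev' h0 1
    rw [sub_self, hΦr.1 U₀] at h1
    exact (WilsonFlow.coeConfig_injective h1).symm

/-- Continuity in the initial field of the Jacobian integral `V ↦ ∫₀¹ ∑ ∂^a[Z_s]^a(Φ_s V) ds` of (3.9) for a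
gradient generator with jointly continuous flow map. [cite: Luscher2010Trivializing, §3.2 eq. (3.9)] -/
theorem continuous_integral_linkDiv_flowMap (B : SuBasis n) {F : ℝ → AmbConfig d L n → ℝ}
    (hF : ContDiff ℝ ∞ fun p : ℝ × AmbConfig d L n => F p.1 p.2)
    {Φ : ℝ → GaugeConfig d L (Matrix.specialUnitaryGroup (Fin n) ℂ) →
      GaugeConfig d L (Matrix.specialUnitaryGroup (Fin n) ℂ)}
    (hΦc : Continuous fun p : ℝ × GaugeConfig d L (Matrix.specialUnitaryGroup (Fin n) ℂ) => Φ p.1 p.2) :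
    Continuous fun V : GaugeConfig d L (Matrix.specialUnitaryGroup (Fin n) ℂ) =>
      ∫ s in (0 : ℝ)..1, linkDiv B (fun W => -linkGrad B (F s) W) (WilsonFlow.coeConfig (Φ s V)) := by
  have hpair : Continuous fun p : GaugeConfig d L (Matrix.specialUnitaryGroup (Fin n) ℂ) × ℝ =>
      ((p.2, WilsonFlow.coeConfig (Φ p.2 p.1)) : ℝ × AmbConfig d L n) :=
    continuous_snd.prodMk (WilsonFlow.continuous_coeConfig.comp
      (hΦc.comp (continuous_snd.prodMk continuous_fst)))
  have hg := (contDiff_linkLap_param B hF).continuous.comp hpair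
  have heq : (fun p : GaugeConfig d L (Matrix.specialUnitaryGroup (Fin n) ℂ) × ℝ =>
      linkDiv B (fun W => -linkGrad B (F p.2) W) (WilsonFlow.coeConfig (Φ p.2 p.1))) =
      (fun p : ℝ × AmbConfig d L n => linkLap B (F p.1) p.2) ∘
        fun p : GaugeConfig d L (Matrix.specialUnitaryGroup (Fin n) ℂ) × ℝ =>
          ((p.2, WilsonFlow.coeConfig (Φ p.2 p.1)) : ℝ × AmbConfig d L n) :=
    funext fun p => linkDiv_neg_linkGrad B (F p.2) _
  have hint : Continuous fun p : GaugeConfig d L (Matrix.specialUnitaryGroup (Fin n) ℂ) × ℝ =>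
      linkDiv B (fun W => -linkGrad B (F p.2) W) (WilsonFlow.coeConfig (Φ p.2 p.1)) := by
    rw [heq]
    exact hg
  exact intervalIntegral.continuous_parametric_intervalIntegral_of_continuous'
    (f := fun (V : GaugeConfig d L (Matrix.specialUnitaryGroup (Fin n) ℂ)) (s : ℝ) =>
      linkDiv B (fun W => -linkGrad B (F s) W) (WilsonFlow.coeConfig (Φ s V))) hint 0 1

end FlowMaps

/-! ## §3. Measure-theoretic packaging -/

section Packaging

variable [NeZero L]

/-- **Pushforwards of Haar measure are determined by continuous observables**: if
`∫ f · h dU = ∫ f(T V) dV` for every bounded continuous `f` (`h ≥ 0` continuous, `T` measurable), then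
`T_* D[V] = h · D[U]` — the step from the Jacobian formula (3.9), stated for continuous observables, to an
identity of measures (finite Borel measures on the metrizable compact field manifold are separated by bounded
continuous functions). [cite: Luscher2010Trivializing, §2.2 eq. (2.4), §3.2 eq. (3.9)] -/
theorem map_trivialMeasure_eq_withDensity
    {T : GaugeConfig d L (Matrix.specialUnitaryGroup (Fin n) ℂ) →
      GaugeConfig d L (Matrix.specialUnitaryGroup (Fin n) ℂ)} (hT : Measurable T)
    {h : GaugeConfig d L (Matrix.specialUnitaryGroup (Fin n) ℂ) → ℝ} (hh : Continuous h)
    (hnn : ∀ U, 0 ≤ h U)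
    (key : ∀ f : GaugeConfig d L (Matrix.specialUnitaryGroup (Fin n) ℂ) →ᵇ ℝ,
      ∫ U, f U * h U ∂(trivialMeasure (Matrix.specialUnitaryGroup (Fin n) ℂ) d L) =
        ∫ V, f (T V) ∂(trivialMeasure (Matrix.specialUnitaryGroup (Fin n) ℂ) d L)) :
    Measure.map T (trivialMeasure (Matrix.specialUnitaryGroup (Fin n) ℂ) d L) =
      (trivialMeasure (Matrix.specialUnitaryGroup (Fin n) ℂ) d L).withDensity
        (fun U => ENNReal.ofReal (h U)) := by
  haveI : SecondCountableTopology (Matrix (Fin n) (Fin n) ℂ) :=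
    inferInstanceAs (SecondCountableTopology (Fin n → Fin n → ℂ))
  haveI : SecondCountableTopology (Matrix.specialUnitaryGroup (Fin n) ℂ) :=
    Topology.IsEmbedding.subtypeVal.secondCountableTopology
  haveI : IsProbabilityMeasure (trivialMeasure (Matrix.specialUnitaryGroup (Fin n) ℂ) d L) := by
    unfold trivialMeasure; infer_instance
  have hhm : Measurable fun U => ENNReal.ofReal (h U) := ENNReal.measurable_ofReal.comp hh.measurable
  haveI : IsFiniteMeasure ((trivialMeasure (Matrix.specialUnitaryGroup (Fin n) ℂ) d L).withDensity
      (fun U => ENNReal.ofReal (h U))) :=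
    isFiniteMeasure_withDensity_ofReal
      ((BoundedContinuousFunction.mkOfCompact ⟨h, hh⟩).integrable _).hasFiniteIntegral
  refine ext_of_forall_integral_eq_of_IsFiniteMeasure fun f => ?_
  rw [integral_map hT.aemeasurable f.continuous.aestronglyMeasurable,
    integral_withDensity_eq_integral_toReal_smul hhm
      (Filter.Eventually.of_forall fun _ => ENNReal.ofReal_lt_top), ← key f]
  refine integral_congr_ae (Filter.Eventually.of_forall fun U => ?_)
  show f U * h U = (ENNReal.ofReal (h U)).toReal • f U
  rw [ENNReal.toReal_ofReal (hnn U), smul_eq_mul]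
  exact mul_comm _ _

/-- **Boltzmann reweighting**: `e^{-S-g} D[U] = (𝒵 e^{-g}) · 𝒵⁻¹ e^{-S} D[U]` for continuous `S, g` on the
compact field manifold (`0 < 𝒵 < ∞`). [cite: Luscher2010Trivializing, §2.1 eq. (2.2)] -/
theorem withDensity_exp_neg_add_eq_boltzmann
    {S g : GaugeConfig d L (Matrix.specialUnitaryGroup (Fin n) ℂ) → ℝ} (hS : Continuous S)
    (hg : Continuous g) :
    (trivialMeasure (Matrix.specialUnitaryGroup (Fin n) ℂ) d L).withDensity
        (fun U => ENNReal.ofReal (Real.exp (-(S U + g U)))) =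
      (boltzmannMeasure S).withDensity
        (fun U => ENNReal.ofReal ((partitionFn S).toReal * Real.exp (-g U))) := by
  haveI : SecondCountableTopology (Matrix (Fin n) (Fin n) ℂ) :=
    inferInstanceAs (SecondCountableTopology (Fin n → Fin n → ℂ))
  haveI : SecondCountableTopology (Matrix.specialUnitaryGroup (Fin n) ℂ) :=
    Topology.IsEmbedding.subtypeVal.secondCountableTopology
  obtain ⟨hZ0, hZtop⟩ := partitionFn_ne_zero_and_ne_top (d := d) (L := L) hS
  have hm1 : Measurable fun U => ENNReal.ofReal (Real.exp (-S U)) :=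
    ENNReal.measurable_ofReal.comp (Real.continuous_exp.comp hS.neg).measurable
  have hm2 : Measurable fun U => ENNReal.ofReal ((partitionFn S).toReal * Real.exp (-g U)) :=
    ENNReal.measurable_ofReal.comp
      (continuous_const.mul (Real.continuous_exp.comp hg.neg)).measurable
  have hm12 : Measurable ((fun U => ENNReal.ofReal (Real.exp (-S U))) * fun U =>
      ENNReal.ofReal ((partitionFn S).toReal * Real.exp (-g U))) := hm1.mul hm2
  unfold boltzmannMeasure
  rw [withDensity_smul_measure, ← withDensity_mul _ hm1 hm2, ← withDensity_smul _ hm12]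
  congr 1
  funext U
  simp only [Pi.smul_apply, Pi.mul_apply, smul_eq_mul]
  rw [ENNReal.ofReal_mul ENNReal.toReal_nonneg, ENNReal.ofReal_toReal hZtop,
    mul_left_comm (ENNReal.ofReal (Real.exp (-S U))), ← mul_assoc, ENNReal.inv_mul_cancel hZ0 hZtop,
    one_mul, ← ENNReal.ofReal_mul (Real.exp_nonneg _), ← Real.exp_add, neg_add]

end Packaging

section Main

/-- `x · e^{-(a + (J - a))} · e^{J} = x`. [folklore] -/
private theorem mul_exp_neg_cancel (x a J : ℝ) :
    x * Real.exp (-(a + (J - a))) * Real.exp J = x := by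
  rw [mul_assoc, ← Real.exp_add, show -(a + (J - a)) + J = 0 by ring, Real.exp_zero, mul_one]

/-- **The flow-equation defect controls the log-weight** (typed target `DefectControlsLogWeight` of
`Truncation.lean`, §3), *conditionally on* the two cited analytic inputs of Lüscher §3: global existence,
uniqueness and continuity of tangent flows on `SU(n)^E` (`FlowGlobalExistence`) and the Jacobian formula (3.9)
(`JacobianFormula`). Given those, if `Φ` integrates `Z_t = -∂S̃_t` for a jointly smooth family `S̃_t` and the
defect of the trivializing-flow equation (4.5) satisfies `|𝓛_t S̃_t - S - Ċ_t| ≤ δ` on `[0,1] × SU(n)^E`, then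
`(Φ₁)_* D[V] = ρ · 𝒵⁻¹ e^{-S} D[U]` with `ρ > 0` measurable and `ρ(U) ≤ e^{2δ} ρ(U')`.
Proof: (i) by uniqueness, `Φ` is THE global flow, hence jointly continuous, and integrating the reversed
generator `+∂S̃_{1-t}` gives a continuous two-sided inverse `Ψ` of `Φ₁` (§3.2 "integrated backwards");
(ii) with `R(V) = ∫₀¹ div Z_s(Φ_s V) ds - S(Φ₁ V)` (`= -C₁ - ∫₀¹ D_s(Φ_s V) ds` by (3.2)+(4.3),
`integral_linkDiv_flowLine`), `|R(V) - R(V')| ≤ 2δ` (`logWeight_osc_le_of_defect`) and `R` is continuous;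
(iii) (3.9) at `t = 1` with the observable `O = f · e^{-S - R∘Ψ}` gives `∫ f e^{-S-R∘Ψ} dU = ∫ f(Φ₁V) dV`
for every bounded continuous `f`, so `(Φ₁)_* D[V] = e^{-S-R∘Ψ} D[U]`; (iv) `ρ = 𝒵 e^{-R∘Ψ}`.
[cite: Luscher2010Trivializing, §3.2 eq. (3.9), §4.1 eqs. (4.1)–(4.3), §4.2 eq. (4.5)] -/
theorem defectControlsLogWeight_of (hGE : FlowGlobalExistence d L n) (hJ : JacobianFormula d L n) :
    DefectControlsLogWeight d L n := by
  intro _ B S F c Φ δ hS hF hΦ hmeas hδ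
  haveI : SecondCountableTopology (Matrix (Fin n) (Fin n) ℂ) :=
    inferInstanceAs (SecondCountableTopology (Fin n → Fin n → ℂ))
  haveI : SecondCountableTopology (Matrix.specialUnitaryGroup (Fin n) ℂ) :=
    Topology.IsEmbedding.subtypeVal.secondCountableTopology
  -- (a)+(b) the generator; `Φ` is the global flow (joint continuity); the inverse of `Φ 1`
  have hZ1 := contDiff_one_neg_linkGrad_param B hF
  have hZtan := isTangent_neg_linkGrad B F
  obtain ⟨hΦc, -⟩ := isFlowMap_continuous_unique hGE hZ1 hZtan hΦ
  have hΦ1c : Continuous (Φ 1) := hΦc.comp (continuous_const.prodMk continuous_id)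
  obtain ⟨Ψ, hΨc, hΨl, hΨr⟩ := exists_continuous_inverse_flowMap_one hGE B hF hΦ
  -- (c) the log-weight `R`
  obtain ⟨R, hR⟩ : ∃ R : GaugeConfig d L (Matrix.specialUnitaryGroup (Fin n) ℂ) → ℝ, ∀ V, R V =
      (∫ s in (0 : ℝ)..1, linkDiv B (fun W => -linkGrad B (F s) W) (WilsonFlow.coeConfig (Φ s V))) -
        S (WilsonFlow.coeConfig (Φ 1 V)) := ⟨_, fun V => rfl⟩
  have hRosc : ∀ V V', |R V - R V'| ≤ 2 * δ := fun V V' => by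
    rw [hR, hR]
    exact logWeight_osc_le_of_defect B hS hF hΦ hδ V V'
  have hS'c : Continuous fun U : GaugeConfig d L (Matrix.specialUnitaryGroup (Fin n) ℂ) =>
      S (WilsonFlow.coeConfig U) := hS.continuous.comp WilsonFlow.continuous_coeConfig
  have hRc : Continuous R := by
    have hR' : R = fun V => (∫ s in (0 : ℝ)..1, linkDiv B (fun W => -linkGrad B (F s) W)
        (WilsonFlow.coeConfig (Φ s V))) - S (WilsonFlow.coeConfig (Φ 1 V)) := funext hR
    rw [hR']
    exact (continuous_integral_linkDiv_flowMap B hF hΦc).sub (hS'c.comp hΦ1c)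
  -- (d) the Jacobian formula (3.9) at `t = 1`, tested against `f · e^{-S - R∘Ψ}`
  have hhc : Continuous fun U : GaugeConfig d L (Matrix.specialUnitaryGroup (Fin n) ℂ) =>
      Real.exp (-(S (WilsonFlow.coeConfig U) + R (Ψ U))) :=
    Real.continuous_exp.comp (hS'c.add (hRc.comp hΨc)).neg
  have key : ∀ f : GaugeConfig d L (Matrix.specialUnitaryGroup (Fin n) ℂ) →ᵇ ℝ,
      ∫ U, f U * Real.exp (-(S (WilsonFlow.coeConfig U) + R (Ψ U)))
          ∂(trivialMeasure (Matrix.specialUnitaryGroup (Fin n) ℂ) d L) =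
        ∫ V, f (Φ 1 V) ∂(trivialMeasure (Matrix.specialUnitaryGroup (Fin n) ℂ) d L) := by
    intro f
    have hO : Continuous fun U : GaugeConfig d L (Matrix.specialUnitaryGroup (Fin n) ℂ) =>
        f U * Real.exp (-(S (WilsonFlow.coeConfig U) + R (Ψ U))) := f.continuous.mul hhc
    have hJ1 : ∫ U, f U * Real.exp (-(S (WilsonFlow.coeConfig U) + R (Ψ U)))
          ∂(trivialMeasure (Matrix.specialUnitaryGroup (Fin n) ℂ) d L) =
        ∫ V, f (Φ 1 V) * Real.exp (-(S (WilsonFlow.coeConfig (Φ 1 V)) + R (Ψ (Φ 1 V)))) *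
          Real.exp (∫ s in (0 : ℝ)..1, linkDiv B (fun W => -linkGrad B (F s) W)
            (WilsonFlow.coeConfig (Φ s V))) ∂(trivialMeasure (Matrix.specialUnitaryGroup (Fin n) ℂ) d L) :=
      hJ B (fun t W => -linkGrad B (F t) W) Φ hZ1 hZtan hΦ 1 _ hO
    rw [hJ1]
    refine integral_congr_ae (Filter.Eventually.of_forall fun V => ?_)
    simp only [hΨl, hR]
    exact mul_exp_neg_cancel _ _ _
  -- (e) identification of the pushforward; the density `ρ = 𝒵 · e^{-R∘Ψ}`
  have hmap := map_trivialMeasure_eq_withDensity (hmeas 1) hhc (fun U => (Real.exp_pos _).le) key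
  obtain ⟨hZ0, hZtop⟩ := partitionFn_ne_zero_and_ne_top (d := d) (L := L) hS'c
  refine ⟨fun U => (partitionFn fun U : GaugeConfig d L (Matrix.specialUnitaryGroup (Fin n) ℂ) =>
      S (WilsonFlow.coeConfig U)).toReal * Real.exp (-R (Ψ U)), ?_, ?_, ?_, ?_⟩
  · exact (continuous_const.mul (Real.continuous_exp.comp (hRc.comp hΨc).neg)).measurable
  · exact fun U => mul_pos (ENNReal.toReal_pos hZ0 hZtop) (Real.exp_pos _)
  · rw [hmap]
    exact withDensity_exp_neg_add_eq_boltzmann hS'c (hRc.comp hΨc)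
  · intro U U'
    have h := (abs_le.1 (hRosc (Ψ U') (Ψ U))).2
    calc (partitionFn fun U : GaugeConfig d L (Matrix.specialUnitaryGroup (Fin n) ℂ) =>
            S (WilsonFlow.coeConfig U)).toReal * Real.exp (-R (Ψ U))
        ≤ (partitionFn fun U : GaugeConfig d L (Matrix.specialUnitaryGroup (Fin n) ℂ) =>
            S (WilsonFlow.coeConfig U)).toReal * (Real.exp (2 * δ) * Real.exp (-R (Ψ U'))) := by
          refine mul_le_mul_of_nonneg_left ?_ ENNReal.toReal_nonneg
          rw [← Real.exp_add]
          exact Real.exp_le_exp.2 (by linarith)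
      _ = Real.exp (2 * δ) * ((partitionFn fun U : GaugeConfig d L (Matrix.specialUnitaryGroup (Fin n) ℂ) =>
            S (WilsonFlow.coeConfig U)).toReal * Real.exp (-R (Ψ U'))) := by ring

end Main

end Summit.Ventures.LatticeQCDFlow.TrivializingMaps
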